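import Literature.IUT.HodgeArakelov.EtaleThetaDataOfSettingCommutatorPairingAut

/-!
# [IUTchII] Prop 3.4 (i) / Cor 1.11 (b), binder `hgal`: the cyclotomic half (HCYC) REDUCED to the Kummer class of `q_X` — the
# cyclotome exponent of a topological automorphism of `Π^tp_{X̲̲}` lying over `Inn(τ)|_{G_K}` satisfies the `q`-Kummer relation
# («HCYC-FROM-HGAL», file 2 of 2)

S. Mochizuki, *Inter-universal Teichmüller theory II*, kurims manuscript (Dec. 2020): Prop 3.4 (i) pp. 91–92, Cor 1.11 (b)
p. 49 [cite: Mochizuki2012, Prop 3.4 (i) p.92] — claim key DISPUTED (D-0012).  Refereed inputs ([EtTh] = S. Mochizuki, Publ.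
RIMS **45** (2009)): §1 pp. 12–13 («`Δ_Θ (≅ Ẑ(1))`», «`(Δ^tp_Y)^ell ≅ Ẑ(1)`», «`1 → (Δ^tp_Y)^ell ⊗ ℤ/Nℤ → Gal(Y_N/Y) →
Gal(K_N/K) → 1`, `K_N = K(ζ_N, q_X^{1/N})`»), Def 2.10 p. 44 (`μ_N`), Cor 2.18 (i) p. 60 (= FACT F-0620, BY NAME through
`rangeAutOfCor218i` / `mem_PiYdd_iff_of_cor218_i`); [AbsTopIII] Cor 1.10 pp. 41–44 ((HGAL)).  abc-iut cell, layer L6, WAVE-5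
seat abc-iut-w5-d169 (gen 5; holder lineage of node IUTchII:Prop3.4(i)); GAP-LEDGER G-w5d169-3 / G-w5d145-2, D-row
D-G-w5d169-3 of 2026-08-26T11:4xZ (census correction: the cyclotomic half is not an independent missing functoriality).

PROOF-ONLY (no definition, no `Prop`-valued fact, nothing restated).  THE STATEMENT (`exists_cyclotomeExponent_kummer_relation`):
for a topological automorphism `α` of `Π^tp_{X̲̲}` with (HGAL) `aug(α x) = τ aug(x) τ⁻¹` (`τ ∈ G_{ℚ_p}`), under F-0620 at
`C.rigidData` (the induced automorphism `ᾱ := rangeAutOfCor218i α` of `φ(Π^tp_{X̲̲}) ⊇ l·Δ_Θ`, and `α(Π^tp_{Ÿ̲̲}) = Π^tp_{Ÿ̲̲}`),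
at an origin (`IsEtThOrigin`), for every level `M` (`red_M : l·Δ_Θ ↠ μ_M`, a `CyclotomeMod`) and geometric `Z`-generator `B`:
there are `u ∈ ℤ` — THE exponent through which `ᾱ` acts on `μ_M` (`exists_exponent_of_rangeAut`: `μ_M` cyclic, `ᾱ` respects
`M`-th powers) —, the tempered sign `d = ±1` and `y ∈ Δ^tp_{Y̲̲}` with `α B = B^d y`, such that the `μ_M`-valued Kummer cocycle
`κ(g) := red_M φ[[g,B], B]` of `B` satisfies `κ(g)^u = κ(α g) · (aug(α g)·w)/w` for EVERY `g ∈ Π^tp_{X̲̲}` (`w := (red_M φ[y,B])^d`):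
`u · [κ] = [κ ∘ α]`.  As `κ` factors through `aug` (`phi_kummer_mul_delta`) and `aug ∘ α = Inn(τ) ∘ aug`, this is the relation
`u · [κ₀] = [κ₀ ∘ Inn(τ)]` in `H¹(G_K, μ_M)`.  WHAT IT BUYS (census of node IUTchII:Prop3.4(i) binder (P3) and of
IUTchII:Cor1.11 via abc-iut-w5-d145's `compatible_of_galois`): (HCYC) «`red_M ∘ ᾱ = galMuN τ ∘ red_M` on `l·Δ_Θ`» is
`u ≡ χ_cyc(τ) (mod M)`; granted that `κ₀` is the Kummer class of `q_X` (the §1 Tate clause, abc-iut-L2's `ThetaSetting.IsTateOrigin`,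
p. 13) this follows from the displayed relation by the CLASSICAL Kummer–valuation argument for the finite extension `K/ℚ_p`
(`u·v(q_X) = χ(τ)·v(τ⁻¹ q_X) = χ(τ)·v(q_X)`, `v(q_X) > 0`, `Ẑ` torsion-free) — part 2, not in this file.  The profinite
analogue would only give `u = d²χ(τ)` with `d ∈ Ẑ^×`: the `±1` is the tempered content.
Nothing here asserts anything of [IUTchII] or [EtTh]; no side taken on [IUTchIII] Cor 3.12; typed ≠ proved for the binders.
-/

noncomputable section

open Topology

namespace Literature.IUT.HodgeArakelov

namespace EtaleThetaDataOfSetting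

open Literature.AnabelianGeometry.EtaleTheta Literature.AnabelianGeometry.SemiGraphs

variable {p : ℕ} [Fact p.Prime] {D : Literature.AnabelianGeometry.EtaleTheta.ThetaSetting p}
  {E : D.EtaleThetaData} {l : ℕ} (C : E.DoubleUnderline l)

/-! ### 4. Reduction mod `M`: the cyclotome exponent `u_M(α)` and the `q`-Kummer relation in `μ_M` -/

section Reduction

variable {M : ℕ+} (ν : D.CyclotomeMod l M)

/-- `ζ^M = 1` in `μ_M`. [cite: MochizukiEtTh2009, Def 2.10 p.44] -/
private theorem muN_pow_card (ζ : MuN p M) : ζ ^ ((M : ℕ+) : ℕ) = 1 := by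
  have h := pow_card_eq_one (G := MuN p M) (x := ζ)
  rwa [card_MuN] at h

/-- **The cyclotome exponent**: an automorphism `β` of `φ(Π^tp_{X̲̲})` stabilising `l·Δ_Θ` acts on
`μ_M ≅ (l·Δ_Θ) ⊗ ℤ/M` (through the identification `red`) by ONE exponent `u ∈ ℤ` — `μ_M` is cyclic and `β` respects
`M`-th powers. [cite: MochizukiEtTh2009, Def 2.10 p.44] -/
theorem exists_exponent_of_rangeAut (β : phiRange C ≃* phiRange C)
    (hβ : ∀ t : phiRange C, t ∈ (D.lDeltaTheta l).subgroupOf (phiRange C) ↔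
      β t ∈ (D.lDeltaTheta l).subgroupOf (phiRange C)) :
    ∃ u : ℤ, ∀ (z w : D.lDeltaTheta l),
      ((β ⟨(z : D.GtpTheta), lDeltaTheta_le_phiRange C z.2⟩ : phiRange C) : D.GtpTheta) = (w : D.GtpTheta) →
        ν.red w = ν.red z ^ u := by
  classical
  have hmem : ∀ z : D.lDeltaTheta l,
      ((β ⟨(z : D.GtpTheta), lDeltaTheta_le_phiRange C z.2⟩ : phiRange C) : D.GtpTheta) ∈ D.lDeltaTheta l :=
    fun z => (Subgroup.mem_subgroupOf).1 ((hβ _).1 ((Subgroup.mem_subgroupOf).2 z.2))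
  -- the induced endomorphism of `l·Δ_Θ`
  let βΔ : D.lDeltaTheta l →* D.lDeltaTheta l :=
    { toFun := fun z => ⟨_, hmem z⟩
      map_one' := by
        apply Subtype.ext
        have h1 : (⟨((1 : D.lDeltaTheta l) : D.GtpTheta), lDeltaTheta_le_phiRange C (1 : D.lDeltaTheta l).2⟩ :
            phiRange C) = 1 := Subtype.ext rfl
        change ((β _ : phiRange C) : D.GtpTheta) = 1
        rw [h1, map_one]; rfl
      map_mul' := fun a b => by
        apply Subtype.ext
        have h1 : (⟨((a * b : D.lDeltaTheta l) : D.GtpTheta), lDeltaTheta_le_phiRange C (a * b).2⟩ : phiRange C) =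
            ⟨(a : D.GtpTheta), lDeltaTheta_le_phiRange C a.2⟩ * ⟨(b : D.GtpTheta), lDeltaTheta_le_phiRange C b.2⟩ :=
          Subtype.ext rfl
        change ((β _ : phiRange C) : D.GtpTheta) = _
        rw [h1, map_mul]; rfl }
  have hβΔ : ∀ z : D.lDeltaTheta l,
      ((βΔ z : D.lDeltaTheta l) : D.GtpTheta) = ((β ⟨(z : D.GtpTheta), lDeltaTheta_le_phiRange C z.2⟩ :
        phiRange C) : D.GtpTheta) := fun z => rfl
  obtain ⟨ζ₀, hζ₀⟩ := IsCyclic.exists_generator (α := MuN p M)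
  obtain ⟨z₀, hz₀⟩ := ν.red_surjective ζ₀
  obtain ⟨u, hu⟩ := (Subgroup.mem_zpowers_iff).1 (hζ₀ (ν.red (βΔ z₀)))
  refine ⟨u, fun z w hzw => ?_⟩
  have hw : w = βΔ z := Subtype.ext (by rw [hβΔ]; exact hzw.symm)
  obtain ⟨j, hj⟩ := (Subgroup.mem_zpowers_iff).1 (hζ₀ (ν.red z))
  have h1 : ν.red (z * z₀ ^ (-j)) = 1 := by
    rw [map_mul, map_zpow, hz₀, ← hj, ← zpow_add, add_neg_cancel, zpow_zero]
  obtain ⟨yy, hyy⟩ := (ν.red_ker _).1 h1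
  have hz : z = yy ^ ((M : ℕ+) : ℕ) * z₀ ^ j := by
    rw [← hyy]; group
  rw [hw, ← hj]
  conv_lhs => rw [hz]
  rw [map_mul, map_pow, map_zpow, map_mul, map_pow, map_zpow, muN_pow_card, one_mul, ← hu, ← zpow_mul, ← zpow_mul,
    mul_comm]

end Reduction

/-! ### 5. The `q`-Kummer relation for the cyclotome exponent of `α` (part 1 of (HCYC) ⟸ (HGAL)) -/

section Main

variable (hS : D.Sec2Hyps)

include hS in
/-- A geometric generator of `Gal(Y̲̲/X̲̲) ≅ ℤ`: some `B ∈ Δ^tp_{X̲̲}` with `toLZ B = 1` («`Ÿ̲̲` is geometrically connected over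
`K`», `map_aug_Ydduu`). [cite: MochizukiEtTh2009, Prop 2.2 (iii) p.37] -/
theorem exists_generator_delta : ∃ B : Pi C, aug C B = 1 ∧ C.toLZ B = Multiplicative.ofAdd 1 := by
  have _ := hS
  obtain ⟨h, hh⟩ := C.toLZ_surjective (Multiplicative.ofAdd 1)
  have hmem : D.aug.toMonoidHom (h : D.PiTemp) ∈ (D.GtpYdd ⊓ C.Huu).map D.aug.toMonoidHom := by
    rw [C.map_aug_Ydduu]; exact D.aug_mem_GK _
  obtain ⟨yv, ⟨hyY, hyH⟩, hyaug⟩ := hmem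
  refine ⟨h * (⟨yv, hyH⟩ : Pi C)⁻¹, ?_, ?_⟩
  · change D.aug.toMonoidHom ((h : D.PiTemp) * yv⁻¹) = 1
    rw [map_mul, map_inv, hyaug, mul_inv_cancel]
  · have hy1 : C.toLZ ⟨yv, hyH⟩ = 1 := (toLZ_eq_one_iff C _).2 (D.GtpYdd_le_GtpY hyY)
    rw [map_mul, map_inv, hh, hy1, inv_one, mul_one]

/-- `aug [g, B] = 1` for `B ∈ Δ^tp_{X̲̲}`. [cite: MochizukiEtTh2009, §1 p.12] -/
theorem aug_kummer_eq_one {B : Pi C} (hB : aug C B = 1) (g : Pi C) : aug C (g * B * g⁻¹ * B⁻¹) = 1 := by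
  simp only [map_mul, map_inv, hB, inv_one, mul_one, mul_inv_cancel]

/-- **PART 1 OF «(HCYC) ⟸ (HGAL)» — THE `q`-KUMMER RELATION FOR THE CYCLOTOME EXPONENT OF `α`.**  For a topological
automorphism `α` of `Π^tp_{X̲̲}` lying over `Inn(τ)|_{G_K}` ((HGAL)), under F-0620 ([EtTh] Cor. 2.18 (i), giving the induced
automorphism `ᾱ := rangeAutOfCor218i α` of `φ(Π^tp_{X̲̲}) ⊇ l·Δ_Θ` and `α(Π^tp_{Ÿ̲̲}) = Π^tp_{Ÿ̲̲}`) and at an origin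
(`IsEtThOrigin`: `(Δ^tp_Y)^Θ` abelian), for every level `M` and geometric `Z`-generator `B ∈ Δ^tp_{X̲̲}`: there are
`u ∈ ℤ` (THE exponent through which `ᾱ` acts on `μ_M ≅ (l·Δ_Θ) ⊗ ℤ/M`), the tempered sign `d = ±1` and `y ∈ Δ^tp_{Y̲̲}` with
`α B = B^d y`, such that the `μ_M`-valued Kummer cocycle `κ(g) := red_M φ[[g, B], B]` of `B` satisfies, for EVERY
`g ∈ Π^tp_{X̲̲}`, `κ(g)^u = κ(α g) · (aug(α g) · w − w)` with `w := (red_M φ[y, B])^d` — i.e. `u · [κ] = [κ ∘ α]` as classes.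
Since `κ` factors through `aug` (`red_kummer_mul_delta`) and `aug ∘ α = Inn(τ) ∘ aug`, this says `u · [κ₀] = [κ₀ ∘ Inn(τ)]` in
`H¹(G_K, μ_M)`; when `κ₀` is the Kummer class of `q_X` (the Tate clause `IsTateOrigin`, p. 13) the valuation of `q_X ≠` a
unit forces `u ≡ χ_cyc(τ) (mod M)`, which is (HCYC) — part 2, not in this file. [cite: Mochizuki2012, Prop 3.4 (i) p.92] -/
theorem exists_cyclotomeExponent_kummer_relation (hO : D.IsEtThOrigin) (hq : IsQuotientMap D.toTheta) {N : ℕ+}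
    (μ : D.CyclotomeMod l N) (hC : D.Compat) (h15 : D.Prop15iii E hC) (L : C.CuspLabels) (R : RigidData.{0} N l)
    (hR : R = C.rigidData μ hC hS h15 L) (h218i : R.Cor218_i) (α : (Pi C) ≃ₜ* (Pi C)) (τ : GQp p)
    (hgal : ∀ x : Pi C, aug C (α x) = τ * aug C x * τ⁻¹) {M : ℕ+} (ν : D.CyclotomeMod l M) {B : Pi C}
    (hB : aug C B = 1) (hBY : C.toLZ B = Multiplicative.ofAdd 1) :
    ∃ (u d : ℤ) (y : Pi C) (hy : aug C y = 1), (d = 1 ∨ d = -1) ∧ C.toLZ y = 1 ∧ α B = B ^ d * y ∧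
      (∀ z w : D.lDeltaTheta l,
        ((rangeAutOfCor218i C μ hq hC hS h15 L R hR h218i α ⟨(z : D.GtpTheta), lDeltaTheta_le_phiRange C z.2⟩ :
            phiRange C) : D.GtpTheta) = (w : D.GtpTheta) → ν.red w = ν.red z ^ u) ∧
      (∀ g : Pi C,
        ν.red ⟨phi C ((g * B * g⁻¹ * B⁻¹) * B * (g * B * g⁻¹ * B⁻¹)⁻¹ * B⁻¹),
            phi_commutator_mem_lDeltaTheta C (aug_kummer_eq_one C hB g) hB⟩ ^ u =
          ν.red ⟨phi C ((α g * B * (α g)⁻¹ * B⁻¹) * B * (α g * B * (α g)⁻¹ * B⁻¹)⁻¹ * B⁻¹),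
              phi_commutator_mem_lDeltaTheta C (aug_kummer_eq_one C hB (α g)) hB⟩ *
            (galMuN p M (aug C (α g))
                (ν.red ⟨phi C (y * B * y⁻¹ * B⁻¹), phi_commutator_mem_lDeltaTheta C hy hB⟩ ^ d) *
              (ν.red ⟨phi C (y * B * y⁻¹ * B⁻¹), phi_commutator_mem_lDeltaTheta C hy hB⟩ ^ d)⁻¹)) := by
  have hYdd : ∀ x : Pi C, x ∈ PiYdd C ↔ α x ∈ PiYdd C := mem_PiYdd_iff_of_cor218_i C μ hC hS h15 L R hR h218i α
  obtain ⟨d, hd1, hd⟩ := exists_sign C hS α hYdd hBY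
  obtain ⟨hy, hyY⟩ := corr_mem C α τ hgal hB hBY hd
  set y := B ^ (-d) * α B with hydef
  have hαB : α B = B ^ d * y := by rw [hydef]; group
  obtain ⟨u, hu⟩ := exists_exponent_of_rangeAut C ν (rangeAutOfCor218i C μ hq hC hS h15 L R hR h218i α).toMulEquiv
    (mem_lDeltaTheta_iff_rangeAutOfCor218i C μ hq hC hS h15 L R hR h218i α)
  refine ⟨u, d, y, hy, hd1, hyY, hαB, hu, fun g => ?_⟩
  -- the GtpTheta identity of §3, read through `red`
  have key := phi_alpha_kummer C hO hB hBY hS α τ hgal hYdd hd1 hy hyY hαB g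
  have hcy : phi C (y * B * y⁻¹ * B⁻¹) ∈ D.lDeltaTheta l := phi_commutator_mem_lDeltaTheta C hy hB
  have hcαg : phi C ((α g * B * (α g)⁻¹ * B⁻¹) * B * (α g * B * (α g)⁻¹ * B⁻¹)⁻¹ * B⁻¹) ∈ D.lDeltaTheta l :=
    phi_commutator_mem_lDeltaTheta C (aug_kummer_eq_one C hB (α g)) hB
  have hconj : phi C (α g) * phi C (y * B * y⁻¹ * B⁻¹) * (phi C (α g))⁻¹ ∈ D.lDeltaTheta l :=
    (D.lDeltaTheta_normal l).conj_mem _ hcy _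
  have ht : phi C (α g) * phi C (y * B * y⁻¹ * B⁻¹) * (phi C (α g))⁻¹ * (phi C (y * B * y⁻¹ * B⁻¹))⁻¹ ∈
      D.lDeltaTheta l := mul_mem hconj (inv_mem hcy)
  -- apply `hu` with `z := φ[k g, B]`, `w := ᾱ z`
  have hw := hu ⟨_, phi_commutator_mem_lDeltaTheta C (aug_kummer_eq_one C hB g) hB⟩
    (⟨_, hcαg⟩ * ⟨_, ht⟩ ^ d) (by
      rw [Subgroup.coe_mul, SubgroupClass.coe_zpow, ← key]
      exact coe_rangeAut_phiR C α _ hq _)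
  rw [← hw, map_mul, map_zpow]
  congr 1
  -- the coboundary term through `red_conj`
  have hsplit : (⟨_, ht⟩ : D.lDeltaTheta l) = ⟨_, hconj⟩ * (⟨_, hcy⟩)⁻¹ := Subtype.ext rfl
  have hrc := ν.red_conj ((α g : Pi C) : D.PiTemp) ⟨_, hcy⟩
  have hconj' : ν.red ⟨_, hconj⟩ = galMuN p M (aug C (α g)) (ν.red ⟨_, hcy⟩) := hrc
  rw [hsplit, map_mul, map_inv, hconj', mul_zpow, inv_zpow, ← map_zpow]

/-- **The Kummer cocycle `κ` factors through `aug`** (`κ(g δ) = κ(g)` for `δ ∈ Δ^tp_{X̲̲}`: `φ[[δ, B], B] = 1` as `φ[δ, B] ∈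
Δ_Θ` is central in `(Δ^tp_X)^Θ`) — so the relation of `exists_cyclotomeExponent_kummer_relation` is a relation between
classes in `H¹(G_K, μ_M)`, `G_K = aug(Π^tp_{X̲̲})`. [cite: MochizukiEtTh2009, §1 p.12] -/
theorem phi_kummer_mul_delta {B : Pi C} (hB : aug C B = 1) (g δ : Pi C) (hδ : aug C δ = 1) :
    phi C (((g * δ) * B * (g * δ)⁻¹ * B⁻¹) * B * ((g * δ) * B * (g * δ)⁻¹ * B⁻¹)⁻¹ * B⁻¹) =
      phi C ((g * B * g⁻¹ * B⁻¹) * B * (g * B * g⁻¹ * B⁻¹)⁻¹ * B⁻¹) := by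
  -- `[g δ, B] = g [δ, B] g⁻¹ · [g, B]`
  have hid : (g * δ) * B * (g * δ)⁻¹ * B⁻¹ = (g * (δ * B * δ⁻¹ * B⁻¹) * g⁻¹) * (g * B * g⁻¹ * B⁻¹) := by group
  have h1 : aug C (g * (δ * B * δ⁻¹ * B⁻¹) * g⁻¹) = 1 := by
    simp only [map_mul, map_inv, hB, hδ, inv_one, mul_one, mul_inv_cancel]
  rw [hid, phi_commutator_mul C hB h1 (aug_kummer_eq_one C hB g)]
  -- `φ[g [δ, B] g⁻¹, B] = 1`: write it as `φ(g) φ[[δ,B], g⁻¹ B g] φ(g)⁻¹`-free form via the class-two identity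
  have hid2 : (g * (δ * B * δ⁻¹ * B⁻¹) * g⁻¹) * B * (g * (δ * B * δ⁻¹ * B⁻¹) * g⁻¹)⁻¹ * B⁻¹ =
      g * ((δ * B * δ⁻¹ * B⁻¹) * (g⁻¹ * B * g) * (δ * B * δ⁻¹ * B⁻¹)⁻¹ * (g⁻¹ * B * g)⁻¹) * g⁻¹ := by group
  have hBg : aug C (g⁻¹ * B * g) = 1 := by
    simp only [map_mul, map_inv, hB, mul_one, inv_mul_cancel]
  have hz : phi C (δ * B * δ⁻¹ * B⁻¹) ∈ D.DeltaTheta := phi_commutator_mem_deltaTheta C hδ hB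
  have hcomm : phi C (δ * B * δ⁻¹ * B⁻¹) * phi C (g⁻¹ * B * g) = phi C (g⁻¹ * B * g) * phi C (δ * B * δ⁻¹ * B⁻¹) :=
    D.deltaTheta_comm_dtpTheta hz (phi_mem_dtpTheta C hBg)
  rw [hid2, map_mul (phi C) (g * _) g⁻¹, map_mul (phi C) g,
    map_mul (phi C) ((δ * B * δ⁻¹ * B⁻¹) * (g⁻¹ * B * g) * (δ * B * δ⁻¹ * B⁻¹)⁻¹) (g⁻¹ * B * g)⁻¹,
    map_mul (phi C) ((δ * B * δ⁻¹ * B⁻¹) * (g⁻¹ * B * g)) (δ * B * δ⁻¹ * B⁻¹)⁻¹,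
    map_mul (phi C) (δ * B * δ⁻¹ * B⁻¹) (g⁻¹ * B * g), hcomm, map_inv, map_inv, mul_assoc (phi C (g⁻¹ * B * g)),
    mul_inv_cancel, mul_one, mul_inv_cancel, mul_one, map_inv, mul_inv_cancel, one_mul]

end Main

end EtaleThetaDataOfSetting

end Literature.IUT.HodgeArakelov

end
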